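import Literature.NumberTheory.Automorphic.QuaternionAlgebraHasse
import Literature.NumberTheory.QuadraticForms.HasseMinkowskiTernaryRat
import HarnessLib

/-!
# Hasse's norm theorem for the quadratic extensions of `ℚ` (Vignéras III Cor. 3.4 over `ℚ`) holds

Topic `NumberTheory/Automorphic`; namespace `Literature.NumberTheory.Automorphic`. One fully proved
theorem: the named fact `hilbertSymbol_eq_one_of_forall_completions K a θ` of
`QuaternionAlgebraHasse.lean` (Vignéras, LNM 800, Ch. III §3 Cor. 3.4: `θ ∈ Kˣ` is a norm from
`K(√a)` as soon as it is a norm from every `K_v(√a)`; equivalently the Hasse–Minkowski theorem for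
ternary forms over `K`) is **discharged for `K = ℚ`** and all `a θ`, by Legendre's theorem /
Hasse–Minkowski for `n = 3` over `ℚ` (`QuadraticForms.hilbertSymbol_rat_eq_one_of_forall_places`,
Serre, *A Course in Arithmetic*, Ch. IV §3.2 Thm. 8 (ii)). Consequently the assemblies of
`QuaternionAlgebraHasse` / `QuaternionAlgebraUniqueness` that take
`(hN : ∀ a θ : K, hilbertSymbol_eq_one_of_forall_completions K a θ)` are unconditional in this
input over `ℚ`.

## References

* M.-F. Vignéras, *Arithmétique des algèbres de quaternions*, LNM 800 (1980), Ch. III §3 Cor. 3.4.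
* J.-P. Serre, *A Course in Arithmetic*, GTM 7 (1973), Ch. IV §3.2 Thm. 8 (ii). [Serre1973]
-/

noncomputable section

namespace Literature.NumberTheory.Automorphic

/-- **Vignéras III Cor. 3.4 over `ℚ` (Hasse's norm theorem for quadratic extensions of `ℚ`)
holds**: for all `a θ : ℚ`, `hilbertSymbol_eq_one_of_forall_completions ℚ a θ` — if
`(a, θ)_v = 1` in every completion `ℚ_v` (finite `v`) and `(a, θ)_w = 1` at the infinite place,
then `(a, θ)_ℚ = 1`. This is the Hasse–Minkowski theorem for ternary forms over `ℚ`
(Legendre; Serre IV §3.2 Thm. 8 (ii)), `QuadraticForms.hilbertSymbol_rat_eq_one_of_forall_places`.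
[cite: VignerasLNM800, Ch. III §3 Cor. 3.4] -/
theorem hilbertSymbol_eq_one_of_forall_completions_rat (a θ : ℚ) :
    hilbertSymbol_eq_one_of_forall_completions ℚ a θ := by
  intro ha hθ hfin hinf
  have ha0 : a ≠ 0 := by
    rintro rfl
    exact ha ⟨0, (mul_zero 0).symm⟩
  exact QuadraticForms.hilbertSymbol_rat_eq_one_of_forall_places ha0 hθ hfin hinf

end Literature.NumberTheory.Automorphic
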